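import Summits.Ventures.QEC.Census.TwoBGA.S8_2x36_w6_k12_00115B0.Data
import HarnessLib

/-!
# Census row `2bga-l2m36-A0-0.1-15-B0-0.0-1.0-6.1-4` — Brouwer–Zimmermann block verdicts 18…26 of the `Z` side (584064 codeword visits; fast twin `bzZBlockF`, `decide +kernel`, tier KERNEL). Part 3/4.
-/

set_option Elab.async false

namespace Summit.Ventures.QEC.Census.S8_2x36_w6_k12_00115B0

/-- Block 18 of the `Z` side replays (64896 codeword visits; fast twin `bzZBlockF`, `decide +kernel`). -/
theorem blkZ_18 : S8_2x36_w6_k12_00115B0.cert.bzZBlockF S8_2x36_w6_k12_00115B0.bz 18 = true := by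
  decide +kernel

/-- Block 19 of the `Z` side replays (64896 codeword visits; fast twin `bzZBlockF`, `decide +kernel`). -/
theorem blkZ_19 : S8_2x36_w6_k12_00115B0.cert.bzZBlockF S8_2x36_w6_k12_00115B0.bz 19 = true := by
  decide +kernel

/-- Block 20 of the `Z` side replays (64896 codeword visits; fast twin `bzZBlockF`, `decide +kernel`). -/
theorem blkZ_20 : S8_2x36_w6_k12_00115B0.cert.bzZBlockF S8_2x36_w6_k12_00115B0.bz 20 = true := by
  decide +kernel

/-- Block 21 of the `Z` side replays (64896 codeword visits; fast twin `bzZBlockF`, `decide +kernel`). -/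
theorem blkZ_21 : S8_2x36_w6_k12_00115B0.cert.bzZBlockF S8_2x36_w6_k12_00115B0.bz 21 = true := by
  decide +kernel

/-- Block 22 of the `Z` side replays (64896 codeword visits; fast twin `bzZBlockF`, `decide +kernel`). -/
theorem blkZ_22 : S8_2x36_w6_k12_00115B0.cert.bzZBlockF S8_2x36_w6_k12_00115B0.bz 22 = true := by
  decide +kernel

/-- Block 23 of the `Z` side replays (64896 codeword visits; fast twin `bzZBlockF`, `decide +kernel`). -/
theorem blkZ_23 : S8_2x36_w6_k12_00115B0.cert.bzZBlockF S8_2x36_w6_k12_00115B0.bz 23 = true := by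
  decide +kernel

/-- Block 24 of the `Z` side replays (64896 codeword visits; fast twin `bzZBlockF`, `decide +kernel`). -/
theorem blkZ_24 : S8_2x36_w6_k12_00115B0.cert.bzZBlockF S8_2x36_w6_k12_00115B0.bz 24 = true := by
  decide +kernel

/-- Block 25 of the `Z` side replays (64896 codeword visits; fast twin `bzZBlockF`, `decide +kernel`). -/
theorem blkZ_25 : S8_2x36_w6_k12_00115B0.cert.bzZBlockF S8_2x36_w6_k12_00115B0.bz 25 = true := by
  decide +kernel

/-- Block 26 of the `Z` side replays (64896 codeword visits; fast twin `bzZBlockF`, `decide +kernel`). -/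
theorem blkZ_26 : S8_2x36_w6_k12_00115B0.cert.bzZBlockF S8_2x36_w6_k12_00115B0.bz 26 = true := by
  decide +kernel

end Summit.Ventures.QEC.Census.S8_2x36_w6_k12_00115B0
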